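import Summits.HodgeConjecture.HodgeCM.Automorphic.IsotypicDecomposition_1

/-! PORT of `HodgeCM/Automorphic/IsotypicDecomposition.lean` (HodgeCMPerL run 82) — part 2: continuation of `Summits.HodgeConjecture.HodgeCM.Automorphic.IsotypicDecomposition_1` (split at a top-level declaration boundary by port_pkg.py; scope re-opened below; declarations unchanged). -/

-- port_pkg: scope re-opened for this part (file-level context, then the namespace/section stack open at the cut)
set_option autoImplicit false
noncomputable section
open scoped InnerProductSpace ComplexConjugate
open ContinuousLinearMap
namespace HodgeCM
namespace RepDecomp
open HodgeCM.PerL34 HodgeCM.PerL34.Spectral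
variable {H : Type*} [NormedAddCommGroup H] [InnerProductSpace ℂ H] [CompleteSpace H]
variable {G : Type*} [Group G]
section Irreducible
variable (R : G →* (H →L[ℂ] H))
variable {R}
variable (R)
/-- **The unitary-equivalence classes** of irreducible subrepresentations — the index set of the isotypic
decomposition (the `σ` of PerL v5 l. 384). -/
abbrev IsoClass : Type _ := Quotient (irrSetoid R)

/-- The class of an irreducible subrepresentation. -/
def classOf (V : Irr R) : IsoClass R := Quotient.mk (irrSetoid R) V

/-- The members of a class. -/
abbrev Members (c : IsoClass R) : Type _ := {V : Irr R // classOf R V = c}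

variable {R}

omit [CompleteSpace H] in
/-- (Ported verbatim from the HodgeCMPerL package; no docstring in the source.) -/
theorem classOf_eq_classOf_iff (V W : Irr R) : classOf R V = classOf R W ↔ Equiv R V.1 W.1 :=
  ⟨fun h => Quotient.exact h, fun h => Quotient.sound h⟩

omit [CompleteSpace H] in
/-- (Ported verbatim from the HodgeCMPerL package; no docstring in the source.) -/
theorem Members.equiv {c : IsoClass R} (V W : Members R c) : Equiv R V.1.1 W.1.1 :=
  (classOf_eq_classOf_iff V.1 W.1).mp (V.2.trans W.2.symm)

variable (R)

/-! ## 4. Isotypic components -/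

/-- **The isotypic component** of the class `c`: the supremum (span) of its members.  PerL's `σ̂` is its closure. -/
def isotypic (c : IsoClass R) : Submodule ℂ H := ⨆ V : Members R c, (V.1.1 : Submodule ℂ H)

variable {R}

omit [CompleteSpace H] in
/-- (Ported verbatim from the HodgeCMPerL package; no docstring in the source.) -/
theorem le_isotypic {c : IsoClass R} (V : Members R c) : V.1.1 ≤ isotypic R c :=
  le_iSup (fun V : Members R c => (V.1.1 : Submodule ℂ H)) V

omit [CompleteSpace H] in
/-- (Ported verbatim from the HodgeCMPerL package; no docstring in the source.) -/
theorem le_isotypic_classOf (V : Irr R) : V.1 ≤ isotypic R (classOf R V) :=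
  le_isotypic (⟨V, rfl⟩ : Members R (classOf R V))

omit [CompleteSpace H] in
/-- **`σ̂` is a subrepresentation** (`hatσ_invariant`). -/
theorem isotypic_invariant (c : IsoClass R) : Invariant R (isotypic R c) := by
  intro g v hv
  refine Submodule.iSup_induction _ (motive := fun v => R g v ∈ isotypic R c) hv ?_ ?_ ?_
  · intro V v hv
    exact le_isotypic V (V.1.2.invariant g v hv)
  · rw [map_zero]
    exact zero_mem _
  · intro x y hx hy
    rw [map_add]
    exact add_mem hx hy

omit [CompleteSpace H] in
/-- The algebraic span of the isotypic components is the span of all irreducible closed invariant subspaces (so the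
carrier's completeness axiom `hatσ_complete` for the DEFINED components reads: "`H` is the closed span of its
irreducible closed `R`-invariant subspaces" — the discrete decomposition of `L²` of a compact quotient). -/
theorem iSup_isotypic_eq : (⨆ c, isotypic R c) = ⨆ V : Irr R, (V.1 : Submodule ℂ H) :=
  le_antisymm (iSup_le fun _ => iSup_le fun V => le_iSup (fun W : Irr R => (W.1 : Submodule ℂ H)) V.1)
    (iSup_le fun V => (le_isotypic_classOf V).trans (le_iSup _ _))

/-- **Distinct isotypic components are orthogonal** (`hatσ_ortho`, algebraic form). -/
theorem isotypic_orthogonal (hR : IsUnitaryRep R) {c d : IsoClass R} (hcd : c ≠ d) :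
    isotypic R c ⟂ isotypic R d := by
  rw [isotypic, Submodule.isOrtho_iSup_left]
  intro V
  rw [isotypic, Submodule.isOrtho_iSup_right]
  intro W
  rcases orthogonal_or_equiv hR V.1.2 W.1.2 with h | h
  · exact h
  · exact absurd (V.2.symm.trans (((classOf_eq_classOf_iff V.1 W.1).mpr h).trans W.2)) hcd

omit [CompleteSpace H] in
/-- (Ported verbatim from the HodgeCMPerL package; no docstring in the source.) -/
theorem IsOrtho.closure {A B : Submodule ℂ H} (h : A ⟂ B) : A.topologicalClosure ⟂ B.topologicalClosure := by
  rw [Submodule.isOrtho_iff_le] at h ⊢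
  rw [Submodule.orthogonal_closure]
  exact A.topologicalClosure_minimal h (Submodule.isClosed_orthogonal B)

/-- `hatσ_ortho` in the carrier's form (for the CLOSED components). -/
theorem isotypic_closure_orthogonal (hR : IsUnitaryRep R) {c d : IsoClass R} (hcd : c ≠ d) :
    ∀ u ∈ (isotypic R c).topologicalClosure, ∀ v ∈ (isotypic R d).topologicalClosure, ⟪u, v⟫_ℂ = 0 :=
  Submodule.isOrtho_iff_inner_eq.mp (IsOrtho.closure (isotypic_orthogonal hR hcd))

end Irreducible

/-! ## 5. Stability under the commutant `R(G)′` — AX9 "e_σ̂ preserves every closed invariant subspace" -/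

section Commutant

variable {R : G →* (H →L[ℂ] H)}

/-- The image of an irreducible subrepresentation `V` under an equivariant isometry `U : V → H` is an irreducible
subrepresentation equivalent to `V`. -/
theorem IsIrreducible.range_of_isometry {V : Submodule ℂ H} (hV : IsIrreducible R V) (U : V →ₗᵢ[ℂ] H)
    (hU : ∀ (g : G) (v v' : V), (v' : H) = R g v → U v' = R g (U v)) :
    IsIrreducible R (LinearMap.range U.toLinearMap) ∧ Equiv R V (LinearMap.range U.toLinearMap) := by
  haveI : CompleteSpace V := hV.isClosed.completeSpace_coe
  set K : Submodule ℂ H := LinearMap.range U.toLinearMap with hKdef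
  have hKcoe : (K : Set H) = Set.range U := by
    ext y
    simp [hKdef]
  have hKc : IsClosed (K : Set H) := by
    rw [hKcoe]
    exact U.isometry.isClosedEmbedding.isClosed_range
  have hKinv : Invariant R K := by
    rintro g _ ⟨x, rfl⟩
    exact ⟨⟨R g (x : H), hV.invariant g _ x.2⟩, hU g x _ rfl⟩
  have hK0 : K ≠ ⊥ := by
    obtain ⟨v, hv, hv0⟩ := Submodule.exists_mem_ne_zero_of_ne_bot hV.ne_bot
    rw [Submodule.ne_bot_iff]
    refine ⟨U ⟨v, hv⟩, ⟨⟨v, hv⟩, rfl⟩, fun h => hv0 ?_⟩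
    have hn := U.norm_map ⟨v, hv⟩
    rw [h, norm_zero, Submodule.coe_norm] at hn
    exact norm_eq_zero.mp hn.symm
  let U₀ : V →ₗᵢ[ℂ] K :=
    { toLinearMap := LinearMap.codRestrict K U.toLinearMap (fun x => ⟨x, rfl⟩)
      norm_map' := fun x => by
        rw [Submodule.coe_norm]
        exact U.norm_map x }
  have hU₀ : ∀ x, ((U₀ x : K) : H) = U x := fun x => rfl
  have hsurj : Function.Surjective U₀ := by
    rintro ⟨_, ⟨x, rfl⟩⟩
    exact ⟨x, rfl⟩
  refine ⟨⟨hKc, hKinv, hK0, ?_⟩, LinearIsometryEquiv.ofSurjective U₀ hsurj, fun g v v' h => ?_⟩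
  · intro K' hK'le hK'c hK'inv
    let V' : Submodule ℂ H := (K'.comap U.toLinearMap).map V.subtype
    have hV'le : V' ≤ V := by
      rintro _ ⟨x, -, rfl⟩
      exact x.2
    have hV'c : IsClosed (V' : Set H) := by
      have hc : (V' : Set H) = Subtype.val '' ((K'.comap U.toLinearMap : Submodule ℂ V) : Set V) :=
        Submodule.map_coe _ _
      rw [hc]
      exact IsClosed.trans (IsClosed.preimage U.continuous hK'c) hV.isClosed
    have hV'inv : Invariant R V' := by
      rintro g _ ⟨x, hx, rfl⟩
      refine ⟨⟨R g (x : H), hV.invariant g _ x.2⟩, ?_, rfl⟩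
      show U ⟨R g (x : H), hV.invariant g _ x.2⟩ ∈ K'
      rw [hU g x _ rfl]
      exact hK'inv g _ hx
    rcases hV.irred V' hV'le hV'c hV'inv with h | h
    · left
      rw [eq_bot_iff]
      intro k hk
      obtain ⟨x, rfl⟩ := hK'le hk
      have hxV' : (x : H) ∈ (⊥ : Submodule ℂ H) := by
        rw [← h]
        exact ⟨x, hk, rfl⟩
      rw [Submodule.mem_bot] at hxV' ⊢
      have hx0 : x = 0 := Subtype.ext hxV'
      rw [hx0]
      exact map_zero _
    · right
      refine le_antisymm hK'le ?_
      rintro _ ⟨x, rfl⟩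
      have hxV' : (x : H) ∈ V' := by
        rw [h]
        exact x.2
      obtain ⟨x', hx', hxx'⟩ := hxV'
      have hx'x : x' = x := Subtype.ext hxx'
      rw [hx'x] at hx'
      exact hx'
  · rw [LinearIsometryEquiv.coe_ofSurjective, hU₀, hU₀]
    exact hU g v v' h

/-- Commutant stability, one member at a time: an operator commuting with `R(G)` maps a member `V` of the class `c`
into `isotypic c`.  (`A|_V` is zero or — Schur — a multiple of an equivariant isometry, whose image is an
irreducible of the same class.) -/
theorem map_member_le_isotypic (hR : IsUnitaryRep R) {c : IsoClass R} (V : Members R c) {A : H →L[ℂ] H}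
    (hA : A ∈ Set.centralizer (Set.range (R : G → (H →L[ℂ] H)))) :
    (V.1.1 : Submodule ℂ H).map A.toLinearMap ≤ isotypic R c := by
  haveI : CompleteSpace V.1.1 := V.1.2.isClosed.completeSpace_coe
  have hρ := V.1.2.schurIrreducible hR
  set ρ := subRep hR V.1.1 V.1.2.isClosed V.1.2.invariant with hρdef
  set T : V.1.1 →L[ℂ] H := A ∘L V.1.1.subtypeL with hTdef
  have hTapply : ∀ v : V.1.1, T v = A (v : H) := fun v => rfl
  have hT : Schur.Intertwines ρ (toUnitary hR) T := by
    intro g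
    ext v
    show A (R g (v : H)) = R g (A (v : H))
    exact (congrArg (fun S : H →L[ℂ] H => S (v : H)) (hA (R g) ⟨g, rfl⟩)).symm
  by_cases h0 : T = 0
  · rintro _ ⟨v, hv, rfl⟩
    have h1 : A v = 0 := by
      rw [← hTapply ⟨v, hv⟩, h0]
      rfl
    show A v ∈ isotypic R c
    rw [h1]
    exact zero_mem _
  · obtain ⟨U, ⟨a, ha, hUa⟩, hU⟩ := Schur.exists_linearIsometry_of_intertwiner_ne_zero hρ hT h0
    have hU' : ∀ (g : G) (v v' : V.1.1), (v' : H) = R g v → U v' = R g (U v) := by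
      intro g v v' h
      have hvv : v' = ((ρ g : unitary (V.1.1 →L[ℂ] V.1.1)) : V.1.1 →L[ℂ] V.1.1) v := Subtype.ext (h.trans rfl)
      rw [hvv]
      exact hU g v
    obtain ⟨hKirr, hKeq⟩ := V.1.2.range_of_isometry U hU'
    have hKcl : classOf R ⟨_, hKirr⟩ = c :=
      ((classOf_eq_classOf_iff ⟨_, hKirr⟩ V.1).mpr (hKeq.symm V.1.2.invariant)).trans V.2
    have hKle : LinearMap.range U.toLinearMap ≤ isotypic R c := le_isotypic ⟨⟨_, hKirr⟩, hKcl⟩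
    rintro _ ⟨v, hv, rfl⟩
    apply hKle
    refine ⟨(a : ℂ)⁻¹ • ⟨v, hv⟩, ?_⟩
    show U ((a : ℂ)⁻¹ • ⟨v, hv⟩) = A v
    have ha' : (a : ℂ) ≠ 0 := by exact_mod_cast ha.ne'
    rw [map_smul, hUa, hTapply, smul_smul, inv_mul_cancel₀ ha', one_smul]

/-- **Commutant stability of the isotypic components**: an operator commuting with `R(G)` maps `isotypic c` into
itself. -/
theorem map_le_isotypic_of_mem_commutant (hR : IsUnitaryRep R) (c : IsoClass R) {A : H →L[ℂ] H}
    (hA : A ∈ Set.centralizer (Set.range (R : G → (H →L[ℂ] H)))) :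
    (isotypic R c).map A.toLinearMap ≤ isotypic R c := by
  rw [isotypic, Submodule.map_iSup]
  exact iSup_le fun V => map_member_le_isotypic hR V hA

/-- The same for the CLOSED isotypic component `σ̂ := closure (isotypic c)`. -/
theorem commutant_mem_closure_isotypic (hR : IsUnitaryRep R) (c : IsoClass R) {A : H →L[ℂ] H}
    (hA : A ∈ Set.centralizer (Set.range (R : G → (H →L[ℂ] H)))) :
    ∀ x ∈ (isotypic R c).topologicalClosure, A x ∈ (isotypic R c).topologicalClosure := by
  intro x hx
  rw [← SetLike.mem_coe, Submodule.topologicalClosure_coe] at hx ⊢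
  exact map_mem_closure A.continuous hx
    (fun y hy => map_le_isotypic_of_mem_commutant hR c hA ⟨y, hy, rfl⟩)

/-- **AX9, ll. 386–387 ("the orthogonal projection `e_σ̂` lies in the von Neumann algebra generated by `R`, hence
preserves every closed `R`-invariant subspace") — PROVED** for the DEFINED `σ̂ = closure (isotypic c)`: by
commutant stability and pv09's bicommutant lemma `Spectral.isotypic_projection_preserves`. -/
theorem starProjection_isotypic_mem (hR : IsUnitaryRep R) (c : IsoClass R) (M : Submodule ℂ H)
    (hMc : IsClosed (M : Set H)) (hM : Invariant R M) :
    ∀ v ∈ M, (isotypic R c).topologicalClosure.starProjection v ∈ M := by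
  haveI : CompleteSpace M := hMc.completeSpace_coe
  exact Spectral.isotypic_projection_preserves hR _ (fun A hA => commutant_mem_closure_isotypic hR c hA) M hM

end Commutant

/-! ## 6. The joint `w`-eigenspace of a torus and AX9 at `w` -/

section Eigen

variable (R : G →* (H →L[ℂ] H)) {Tι : Type*} (ι : Tι → G) (w : Tι → ℂ)

/-- **The joint `w`-eigenspace** `E_w := {v | ∀ t, R (ι t) v = w t • v}` of the family of group elements
`ι : Tι → G` with weights `w` (PerL v5 ll. 390–391, `T(L₀ ⊗ ℝ)` acting through `R`). -/
def Ew : Submodule ℂ H := ⨅ t, Module.End.eigenspace ((R (ι t)).toLinearMap) (w t)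

omit [CompleteSpace H] in
/-- (Ported verbatim from the HodgeCMPerL package; no docstring in the source.) -/
theorem mem_Ew {v : H} : v ∈ Ew R ι w ↔ ∀ t, R (ι t) v = w t • v := by
  simp only [Ew, Submodule.mem_iInf, Module.End.mem_eigenspace_iff]
  rfl

omit [CompleteSpace H] in
/-- `E_w` is closed (so the carrier's `EwC = E_w` and `P_w` is the projection onto `E_w` itself). -/
theorem isClosed_Ew : IsClosed (Ew R ι w : Set H) := by
  have h : (Ew R ι w : Set H) = ⋂ t, {v : H | R (ι t) v = w t • v} := by
    ext v
    simp only [SetLike.mem_coe, mem_Ew, Set.mem_iInter, Set.mem_setOf_eq]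
  rw [h]
  exact isClosed_iInter fun t => isClosed_eq (R (ι t)).continuous (continuous_id.const_smul (w t))

/-- **"`w` occurs in `σ_∞|_T`"** for the class `c` (PerL ll. 387–390): some irreducible of the class meets `E_w`
non-trivially. -/
def WOccurs (c : IsoClass R) : Prop := ∃ V : Members R c, (V.1.1 : Submodule ℂ H) ⊓ Ew R ι w ≠ ⊥

variable {R}

/-- **AX9 at `w` (ll. 435–437) — PROVED**: a closed `R`-invariant subspace `M` meeting the closed isotypic
component `σ̂_c` of a class in which `w` occurs contains a NON-ZERO vector of `E_w` in `M ⊓ σ̂_c`.  (pv13's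
`Schur.exists_isometry_into_of_le_closure_span` applied to the equivariant isometries from the member `V₀` carrying
the `w`-vector onto every member of the class: one of them, compressed to `M ⊓ σ̂_c`, is non-zero, so `V₀` embeds
equivariantly and isometrically into `M ⊓ σ̂_c`, carrying its `w`-vector along.) -/
theorem exists_wvector (hR : IsUnitaryRep R) {c : IsoClass R} (hc : WOccurs R ι w c) (M : Submodule ℂ H)
    (hMc : IsClosed (M : Set H)) (hM : Invariant R M) (hN : M ⊓ (isotypic R c).topologicalClosure ≠ ⊥) :
    ∃ v ∈ M ⊓ (isotypic R c).topologicalClosure, v ≠ 0 ∧ v ∈ Ew R ι w := by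
  obtain ⟨V₀, hV₀⟩ := hc
  obtain ⟨v₀, hv₀, hv₀0⟩ := Submodule.exists_mem_ne_zero_of_ne_bot hV₀
  haveI : CompleteSpace V₀.1.1 := V₀.1.2.isClosed.completeSpace_coe
  have hρ := V₀.1.2.schurIrreducible hR
  set ρ := subRep hR V₀.1.1 V₀.1.2.isClosed V₀.1.2.invariant with hρdef
  have hE : ∀ W : Members R c, Equiv R V₀.1.1 W.1.1 := fun W => Members.equiv V₀ W
  choose e he using hE
  let θ : Members R c → (V₀.1.1 →L[ℂ] H) := fun W =>
    W.1.1.subtypeL ∘L (e W).toLinearIsometry.toContinuousLinearMap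
  have hθapply : ∀ W x, θ W x = ((e W x : W.1.1) : H) := fun W x => rfl
  have hθ : ∀ W, Schur.Intertwines ρ (toUnitary hR) (θ W) := by
    intro W g
    ext x
    exact he W g x (((ρ g : unitary (V₀.1.1 →L[ℂ] V₀.1.1)) : V₀.1.1 →L[ℂ] V₀.1.1) x) rfl
  set N := M ⊓ (isotypic R c).topologicalClosure with hNdef
  have hNc : IsClosed (N : Set H) := by
    rw [hNdef, Submodule.coe_inf]
    exact hMc.inter (Submodule.isClosed_topologicalClosure _)
  have hNinv : Schur.Invariant (Schur.ops (toUnitary hR)) N :=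
    (invariant_iff_schur hR N).mp (hM.inf (isotypic_invariant c).topologicalClosure)
  have hle : N ≤ (⨆ W, LinearMap.range (θ W).toLinearMap).topologicalClosure := by
    refine inf_le_right.trans (Submodule.topologicalClosure_mono (iSup_mono fun W => ?_))
    intro x hx
    refine ⟨(e W).symm ⟨x, hx⟩, ?_⟩
    show θ W ((e W).symm ⟨x, hx⟩) = x
    rw [hθapply, LinearIsometryEquiv.apply_symm_apply]
  obtain ⟨W, U, hUN, -, -, hU, -⟩ :=
    Schur.exists_isometry_into_of_le_closure_span hρ θ hθ N hNc hNinv hN hle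
  refine ⟨U ⟨v₀, hv₀.1⟩, hUN _, ?_, ?_⟩
  · intro h
    apply hv₀0
    have hn := U.norm_map ⟨v₀, hv₀.1⟩
    rw [h, norm_zero, Submodule.coe_norm] at hn
    exact norm_eq_zero.mp hn.symm
  · rw [mem_Ew]
    intro t
    have h1 : ((ρ (ι t) : unitary (V₀.1.1 →L[ℂ] V₀.1.1)) : V₀.1.1 →L[ℂ] V₀.1.1) ⟨v₀, hv₀.1⟩ =
        w t • ⟨v₀, hv₀.1⟩ :=
      Subtype.ext (((mem_Ew R ι w).mp hv₀.2 t).trans rfl)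
    have h2 := hU (ι t) ⟨v₀, hv₀.1⟩
    rw [h1, map_smul] at h2
    exact h2.symm

end Eigen



end RepDecomp
end HodgeCM

end
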